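import Summits.CriticalPhenomena.PercolationContinuityZ3.Theorems.Transplant.GrigorchukWitnessSnowballStep
import Summits.CriticalPhenomena.PercolationContinuityZ3.Theorems.Transplant.SnowballSqueezeStep
import Mathlib.Analysis.Convex.SpecificFunctions.Pow
import Mathlib.Analysis.SpecialFunctions.Pow.Continuity
import HarnessLib

/-!
# A stretched-exponential UPPER growth rate for `Cay(𝔊; a, b, c, d)` in the kernel: `log |B(v, n)| ≤ C·n^{α′} + C` for SOME `α′ < 1`
# (the (L-c) input of the D12 uniqueness zone, DISCHARGED from the tree's level-one growth recursion — no numerical exponent typed)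

builds on p205010 (kernel theorem, internal audit signed; external expert review pending) — nothing in this file uses p205010; pure growth combinatorics /
real analysis over the tree's Grigorchuk files.  Lane `prim-bschramm`, seat `prim-bschramm-stmt` gen 41 (port pen) under lead g28's assignment #9400 and
the design desk's recipe (p3 g41 #9397).  Proof-only helper file (`--supports stmt-CriticalPhenomena-4575 --as helper`): NO definition, no `@[conjecture]`,
nothing about `θ(p_c)`; it asserts an upper growth RATE that Grigorchuk 1984 proves in print and that the tree's recursion already encodes.

THE INPUT (tree, «GrigorchukGrowthRecursion» p610xxx): the level-one weighted growth recursion with Bartholdi's weights,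
`gammaW_recursion (n) : ∃ i j, i + j ≤ ⌊13(n+6000)/16⌋ ∧ γ_w(n) ≤ 2·(⌊13(n+6000)/16⌋ + 1)·γ_w(i)·γ_w(j)` (contraction `η = 13/16`), from which
«GrigorchukSubexponentialGrowth» derived only the `ε`-descent (`gammaW_le_exp`: rate `τ` for every `τ > 0`, no stretched rate).
THE ARGUMENT (the classical concavity induction, `ε`-free, with NO closed-form exponent): put `f = log γ_w`.  For `n ≥ 39000` the recursion's
`m = ⌊13(n+6000)/16⌋` satisfies `m ≤ (15/16)·n` and `m < n`; by concavity of `x ↦ x^α` (`0 ≤ α ≤ 1`; Mathlib `Real.concaveOn_rpow` at weights `½, ½`)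
`i^α + j^α ≤ 2·((i+j)/2)^α ≤ 2·(15/32)^α·n^α =: ρ(α)·n^α`, and `ρ(α) = 2·(15/32)^α` is continuous in `α` with `ρ(1) = 15/16 < 1`, so SOME `α ∈ [1/2, 1)`
has `ρ(α) < 1` (Mathlib `continuousAt_const_rpow`) — we never compute it (in print the level-one recursion gives every `α′ > log 2/log(32/13) ≈ 0.7695`,
and three levels give Bartholdi's `0.7674`; neither value is typed).  A strong induction then gives `f(n) ≤ A·n^α + B` for all `n`: below `39000` by the
crude bound `γ_w(n) ≤ 24·3ⁿ` (`gammaW_le_exp_log_three`, `B := log 24 + 39000·log 3`), above by the recursion, the induction hypothesis at `i, j < n`,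
concavity, and `log(2(m+1)) ≤ log(2n) ≤ 2n^α/α` (`Real.log_le_rpow_div`), with `A := (B + 2/α)/(1 − ρ)`.  TRANSFER: `|B_{Cay(𝔊)}(1, n)| ≤ γ_w(3400·n)`
(«GrigorchukSubexponentialGrowth» `ballVolume_le_gammaW`) and vertex-transitivity («SnowballSqueezeStep» `ballVolume_eq_of_isGraphTransitive`).

* §1 two real-analysis helpers: `rpow_add_rpow_le` (concavity at `½, ½`), `exists_contraction_exponent` (`∃ α ∈ [1/2, 1)` with `2·(15/32)^α < 1`).
* §2 **`log_gammaW_le_stretched : ∃ α A B, 1/2 ≤ α ∧ α < 1 ∧ 0 ≤ A ∧ ∀ n, log γ_w(n) ≤ A·n^α + B`** (the induction).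
* §3 **`stdCay_log_ballVolume_le_stretched : ∃ α′ C, 0 < α′ ∧ α′ < 1 ∧ 0 < C ∧ ∀ v n, log |B_{Cay(𝔊;a,b,c,d)}(v, n)| ≤ C·n^{α′} + C`** — the (L-c) input of
  the D12 chain («GrigorchukWitnessUniquenessZone», gen-1 g11) in raw form; the `Cay(𝔊 × ℤ)` version with its `(2n+1)` factor is taken there.
[cite: Grigorchuk1984, Thm. (upper bound)] [cite: Bartholdi1998, Prop. (η = 13/16 weights; the exponent)]
-/

noncomputable section

namespace Summit.CriticalPhenomena.PercolationContinuityZ3.Theorems.Transplant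

namespace Grigorchuk

open Real Filter Literature.Barriers.CriticalPhenomena
open scoped Topology

/-! ### §1 Real-analysis helpers -/

/-- **Concavity of `x ↦ x^α` at weights `½, ½`** (`0 ≤ α ≤ 1`, `x, y ≥ 0`): `x^α + y^α ≤ 2·((x + y)/2)^α`. [folklore] -/
theorem rpow_add_rpow_le {α x y : ℝ} (hα0 : 0 ≤ α) (hα1 : α ≤ 1) (hx : 0 ≤ x) (hy : 0 ≤ y) :
    x ^ α + y ^ α ≤ 2 * ((x + y) / 2) ^ α := by
  have h := (Real.concaveOn_rpow hα0 hα1).2 (Set.mem_Ici.2 hx) (Set.mem_Ici.2 hy) (show (0 : ℝ) ≤ 1 / 2 by norm_num)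
    (show (0 : ℝ) ≤ 1 / 2 by norm_num) (show (1 : ℝ) / 2 + 1 / 2 = 1 by norm_num)
  simp only [smul_eq_mul] at h
  have e : (1 : ℝ) / 2 * x + 1 / 2 * y = (x + y) / 2 := by ring
  rw [e] at h
  linarith

/-- **A contraction exponent exists, uncomputed**: `ρ(α) = 2·(15/32)^α` is continuous with `ρ(1) = 15/16 < 1`, so some `α ∈ [1/2, 1)` has `ρ(α) < 1`.
[folklore] -/
theorem exists_contraction_exponent : ∃ α : ℝ, 1 / 2 ≤ α ∧ α < 1 ∧ 2 * (15 / 32 : ℝ) ^ α < 1 := by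
  have hcont : ContinuousAt (fun x : ℝ => 2 * (15 / 32 : ℝ) ^ x) 1 :=
    continuousAt_const.mul (continuousAt_const_rpow (by norm_num))
  have h1 : 2 * (15 / 32 : ℝ) ^ (1 : ℝ) < 1 := by rw [Real.rpow_one]; norm_num
  have hev : ∀ᶠ x in 𝓝 (1 : ℝ), 2 * (15 / 32 : ℝ) ^ x < 1 := hcont.eventually (gt_mem_nhds h1)
  obtain ⟨ε, hε, hball⟩ := Metric.eventually_nhds_iff.1 hev
  refine ⟨1 - min (ε / 2) (1 / 2), ?_, ?_, hball ?_⟩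
  · have : min (ε / 2) (1 / 2) ≤ 1 / 2 := min_le_right _ _
    linarith
  · have : 0 < min (ε / 2) (1 / 2) := lt_min (by linarith) (by norm_num)
    linarith
  · rw [Real.dist_eq, show (1 : ℝ) - min (ε / 2) (1 / 2) - 1 = -min (ε / 2) (1 / 2) by ring, abs_neg,
      abs_of_pos (lt_min (by linarith) (by norm_num))]
    exact lt_of_le_of_lt (min_le_left _ _) (by linarith)

/-! ### §2 The stretched upper rate for the weighted growth function `γ_w` -/

/-- **`log γ_w(n) ≤ A·n^α + B` for some `α < 1`** (the `ε`-free concavity induction over the tree's `gammaW_recursion`; no numerical exponent).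
[cite: Grigorchuk1984, Thm. (upper bound)] [cite: Bartholdi1998, Prop. (η = 13/16)] -/
theorem log_gammaW_le_stretched :
    ∃ α A B : ℝ, 1 / 2 ≤ α ∧ α < 1 ∧ 0 ≤ A ∧ 0 ≤ B ∧ ∀ n : ℕ, Real.log (gammaW n) ≤ A * (n : ℝ) ^ α + B := by
  obtain ⟨α, hα12, hα1, hρ⟩ := exists_contraction_exponent
  have hα0 : 0 < α := by linarith
  set ρ : ℝ := 2 * (15 / 32 : ℝ) ^ α with hρdef
  have hρ0 : 0 ≤ ρ := by positivity
  -- the base constant `B ≥ log γ_w(n)` for `n < 39000`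
  set B : ℝ := Real.log 24 + 39000 * Real.log 3 with hB
  have hlog3 : 0 ≤ Real.log 3 := Real.log_nonneg (by norm_num)
  have hlog24 : 0 ≤ Real.log 24 := Real.log_nonneg (by norm_num)
  have hB0 : 0 ≤ B := by positivity
  -- the crude bound, in log form
  have hcrude : ∀ n : ℕ, Real.log (gammaW n) ≤ Real.log 24 + n * Real.log 3 := by
    intro n
    have h0 : (0 : ℝ) < gammaW n := by exact_mod_cast gammaW_pos n
    have h := gammaW_le_exp_log_three n
    calc Real.log (gammaW n) ≤ Real.log (24 * Real.exp (Real.log 3 * n)) := Real.log_le_log h0 h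
      _ = Real.log 24 + n * Real.log 3 := by rw [Real.log_mul (by norm_num) (Real.exp_pos _).ne', Real.log_exp]; ring
  set A : ℝ := (B + 2 / α) / (1 - ρ) with hA
  have h1ρ : 0 < 1 - ρ := by linarith
  have hA0 : 0 ≤ A := div_nonneg (by positivity) h1ρ.le
  have hAkey : (1 - ρ) * A = B + 2 / α := by rw [hA]; field_simp
  refine ⟨α, A, B, hα12, hα1, hA0, hB0, fun n => ?_⟩
  -- strong induction on `n`
  induction n using Nat.strong_induction_on with
  | _ n ih =>
    by_cases hn : n < 39000
    · -- base range: the crude bound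
      calc Real.log (gammaW n) ≤ Real.log 24 + n * Real.log 3 := hcrude n
        _ ≤ B := by
            rw [hB]
            have : (n : ℝ) ≤ 39000 := by exact_mod_cast hn.le
            nlinarith
        _ ≤ A * (n : ℝ) ^ α + B := by nlinarith [Real.rpow_nonneg (Nat.cast_nonneg n) α]
    · -- the recursion
      have hn : 39000 ≤ n := not_lt.1 hn
      obtain ⟨i, j, hij, hrec⟩ := gammaW_recursion n
      set m : ℕ := 13 * (n + 6000) / 16 with hm
      have hmn : m < n := by omega
      have hm15 : (m : ℝ) ≤ 15 / 16 * n := by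
        have : 16 * m ≤ 15 * n := by omega
        have : (16 : ℝ) * m ≤ 15 * n := by exact_mod_cast this
        linarith
      have hi : i < n := by omega
      have hj : j < n := by omega
      have hγi : (0 : ℝ) < gammaW i := by exact_mod_cast gammaW_pos i
      have hγj : (0 : ℝ) < gammaW j := by exact_mod_cast gammaW_pos j
      have hγn : (0 : ℝ) < gammaW n := by exact_mod_cast gammaW_pos n
      have hm1 : (0 : ℝ) < 2 * ((m : ℝ) + 1) := by positivity
      -- `log γ(n) ≤ log(2(m+1)) + log γ(i) + log γ(j)`
      have hstep : Real.log (gammaW n) ≤ Real.log (2 * ((m : ℝ) + 1)) + Real.log (gammaW i) + Real.log (gammaW j) := by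
        have h : (gammaW n : ℝ) ≤ 2 * ((m : ℝ) + 1) * (gammaW i * gammaW j) := by rw [hm]; exact_mod_cast hrec
        calc Real.log (gammaW n) ≤ Real.log (2 * ((m : ℝ) + 1) * (gammaW i * gammaW j)) := Real.log_le_log hγn h
          _ = _ := by rw [Real.log_mul hm1.ne' (by positivity), Real.log_mul hγi.ne' hγj.ne']; ring
      -- concavity: `i^α + j^α ≤ ρ n^α`
      have hconc : A * (i : ℝ) ^ α + A * (j : ℝ) ^ α ≤ ρ * A * (n : ℝ) ^ α := by
        have h1 : (i : ℝ) ^ α + (j : ℝ) ^ α ≤ 2 * (((i : ℝ) + j) / 2) ^ α :=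
          rpow_add_rpow_le hα0.le hα1.le (Nat.cast_nonneg i) (Nat.cast_nonneg j)
        have hij' : ((i : ℝ) + j) / 2 ≤ 15 / 32 * n := by
          have : ((i : ℝ) + j) ≤ m := by exact_mod_cast hij
          linarith
        have h2 : (((i : ℝ) + j) / 2) ^ α ≤ (15 / 32 * (n : ℝ)) ^ α :=
          Real.rpow_le_rpow (by positivity) hij' hα0.le
        have h3 : (15 / 32 * (n : ℝ)) ^ α = (15 / 32 : ℝ) ^ α * (n : ℝ) ^ α := Real.mul_rpow (by norm_num) (Nat.cast_nonneg n)
        have h4 : (i : ℝ) ^ α + (j : ℝ) ^ α ≤ ρ * (n : ℝ) ^ α := by rw [hρdef]; nlinarith [h1, h2, h3]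
        nlinarith [h4, hA0]
      -- `log(2(m+1)) ≤ log(2n) ≤ 2 n^α / α`
      have hlogm : Real.log (2 * ((m : ℝ) + 1)) ≤ 2 * (n : ℝ) ^ α / α := by
        have hmn' : (m : ℝ) + 1 ≤ n := by exact_mod_cast hmn
        have hn0 : (0 : ℝ) < n := by exact_mod_cast (lt_of_le_of_lt (Nat.zero_le _) hmn)
        calc Real.log (2 * ((m : ℝ) + 1)) ≤ Real.log (2 * n) := Real.log_le_log hm1 (by linarith)
          _ ≤ (2 * (n : ℝ)) ^ α / α := Real.log_le_rpow_div (by positivity) hα0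
          _ = (2 : ℝ) ^ α * (n : ℝ) ^ α / α := by rw [Real.mul_rpow (by norm_num) hn0.le]
          _ ≤ 2 * (n : ℝ) ^ α / α := by
              have h2α : (2 : ℝ) ^ α ≤ 2 := by
                calc (2 : ℝ) ^ α ≤ (2 : ℝ) ^ (1 : ℝ) := Real.rpow_le_rpow_of_exponent_le (by norm_num) hα1.le
                  _ = 2 := Real.rpow_one 2
              have : 0 ≤ (n : ℝ) ^ α / α := div_nonneg (Real.rpow_nonneg hn0.le α) hα0.le
              calc (2 : ℝ) ^ α * (n : ℝ) ^ α / α = (2 : ℝ) ^ α * ((n : ℝ) ^ α / α) := by ring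
                _ ≤ 2 * ((n : ℝ) ^ α / α) := mul_le_mul_of_nonneg_right h2α this
                _ = 2 * (n : ℝ) ^ α / α := by ring
      -- `n^α ≥ 1`
      have hnα : (1 : ℝ) ≤ (n : ℝ) ^ α := by
        have : (1 : ℝ) ≤ n := by exact_mod_cast (Nat.one_le_iff_ne_zero.2 (by omega))
        exact Real.one_le_rpow this hα0.le
      -- assemble
      have hIHi := ih i hi
      have hIHj := ih j hj
      have key : Real.log (2 * ((m : ℝ) + 1)) + (A * (i : ℝ) ^ α + B) + (A * (j : ℝ) ^ α + B) ≤ A * (n : ℝ) ^ α + B := by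
        have h5 : B + 2 * (n : ℝ) ^ α / α ≤ (1 - ρ) * A * (n : ℝ) ^ α := by
          have e : (1 - ρ) * A * (n : ℝ) ^ α = (B + 2 / α) * (n : ℝ) ^ α := by rw [← hAkey]
          rw [e, add_mul]
          have : B ≤ B * (n : ℝ) ^ α := by nlinarith
          have : 2 * (n : ℝ) ^ α / α = 2 / α * (n : ℝ) ^ α := by ring
          linarith
        nlinarith [hconc, hlogm, h5]
      linarith [hstep, hIHi, hIHj, key]

/-! ### §3 Transfer to the balls of `Cay(𝔊; a, b, c, d)` -/

/-- **THE (L-c) INPUT, DISCHARGED: a stretched-exponential UPPER growth rate for `Cay(𝔊; a, b, c, d)` in the kernel** — there are `0 < α′ < 1` and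
`C > 0` with `log |B(v, n)| ≤ C·n^{α′} + C` at EVERY vertex `v` and every `n` (from `log_gammaW_le_stretched`, `|B(1, n)| ≤ γ_w(3400 n)` and
vertex-transitivity).  NO numerical value of `α′` is typed (print: Grigorchuk 1984 / Bartholdi 1998, `α′ = log 2 / log(2/η) ≈ 0.7674`, sharp by
Erschler–Zheng 2020).  Raw form; the D12 chain's hypothesis def `GrowthUpperStretched` is instantiated from it in «GrigorchukWitnessUniquenessZone».
[cite: Grigorchuk1984, Thm. (upper bound)] [cite: Bartholdi1998, Prop. (the exponent)] -/
theorem stdCay_log_ballVolume_le_stretched :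
    ∃ α' C : ℝ, 0 < α' ∧ α' < 1 ∧ 0 < C ∧ ∀ (v : ↥grigorchukGroup) (n : ℕ), Real.log (ballVolume stdCay v n) ≤ C * (n : ℝ) ^ α' + C := by
  obtain ⟨α, A, B, hα12, hα1, hA0, hB0, h⟩ := log_gammaW_le_stretched
  have hα0 : 0 < α := by linarith
  refine ⟨α, max (A * (3400 : ℝ) ^ α) B + 1, hα0, hα1, by positivity, fun v n => ?_⟩
  -- the ball at `v` has the size of the ball at `1`
  have hv : ballVolume stdCay v n = ballVolume stdCay 1 n :=
    (SnowballSqueeze.ballVolume_eq_of_isGraphTransitive stdCay (isGraphTransitive_mulCayley _) v 1 n).symm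
  rw [hv]
  have hpos : (0 : ℝ) < ballVolume stdCay 1 n := by
    have : 1 ≤ ballVolume stdCay 1 n := one_le_ballVolume stdCay 1 n
    exact_mod_cast this
  have hle : (ballVolume stdCay 1 n : ℝ) ≤ gammaW (3400 * n) := by exact_mod_cast ballVolume_le_gammaW n
  have hγ := h (3400 * n)
  have hcast : ((3400 * n : ℕ) : ℝ) ^ α = (3400 : ℝ) ^ α * (n : ℝ) ^ α := by
    rw [Nat.cast_mul, Nat.cast_ofNat, Real.mul_rpow (by norm_num) (Nat.cast_nonneg n)]
  rw [hcast] at hγ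
  have hnα : 0 ≤ (n : ℝ) ^ α := Real.rpow_nonneg (Nat.cast_nonneg n) α
  calc Real.log (ballVolume stdCay 1 n) ≤ Real.log (gammaW (3400 * n)) := Real.log_le_log hpos hle
    _ ≤ A * ((3400 : ℝ) ^ α * (n : ℝ) ^ α) + B := hγ
    _ = (A * (3400 : ℝ) ^ α) * (n : ℝ) ^ α + B := by ring
    _ ≤ (max (A * (3400 : ℝ) ^ α) B + 1) * (n : ℝ) ^ α + (max (A * (3400 : ℝ) ^ α) B + 1) := by
        have h1 : A * (3400 : ℝ) ^ α ≤ max (A * (3400 : ℝ) ^ α) B + 1 := by linarith [le_max_left (A * (3400 : ℝ) ^ α) B]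
        have h2 : B ≤ max (A * (3400 : ℝ) ^ α) B + 1 := by linarith [le_max_right (A * (3400 : ℝ) ^ α) B]
        nlinarith [h1, h2, hnα]

end Grigorchuk

end Summit.CriticalPhenomena.PercolationContinuityZ3.Theorems.Transplant

end
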